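import Summits.NavierStokesRegularity.NavierStokesRegularity.Theorems.AxisymmetricExtremalityAxisymmetricKatoGlobalStubSeregin2020TypeIILemma22MoserEmbed
import Summits.NavierStokesRegularity.NavierStokesRegularity.Theorems.AxisymmetricExtremalityAxisymmetricKatoGlobalStubSeregin2020TypeIILemma22MoserDrift
import HarnessLib

/-!
# Seregin 2020, Lemma 2.2 (after Nazarov–Uraltseva 2012), piece L22-C, atom M1: the Moser step
# `lemma22_moserStep` (one reverse-Hölder step `L^q → L^{5q/3}` in the energy class)

Lands the REGISTERED stub `lemma22_moserStep` of stmt-NavierStokesRegularity-15453 (crux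
`AxisymmetricKatoGlobal`, skeleton `Cruxes/AxisymmetricKatoGlobal/Seregin2020Lemma22ExpansionOfPositivity.lean`
v4, the M1/M2 split of N–U Lemma 3.1: seat c iterates this step in M2 =
`lemma22_smallSublevel_lowerBound`). Statement (verbatim from the registry): for `N`, `Θmax` there
are `C₀, A ≥ 0` such that in the standing class (measurable `Φ ≥ 0`, `C¹` slices a.e., drift bound
`∫(∫|U|³)^{4/3} ≤ N R²`, the energy class) and for nested cylinders
`Q′ = ]t₀-Θ₂ρ², t₀[ × B(Λ₂ρ) ⊂ Q = ]t₀-Θ₁ρ², t₀[ × B(Λ₁ρ)` with gaps `dl`, `dθ`: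
(i) `∫∫_{Q′} (l-Φ)₊^{5q/3} ≤ C₀ (dl·dθ)^{-A} ρ^{-10/3} (∫∫_Q (l-Φ)₊^q)^{5/3}`; (ii) if
`Φ(t₀-Θ₁ρ²,·) ≥ l` a.e. on `B(Λ₁ρ)`, the same on `]t₀-Θ₁ρ², t₀[ × B(Λ₂ρ)` with `C₀ dl^{-A}`. Here
`A = 10`.

Proof (N–U (3.2)–(3.6) with Remarks 5, 6, 9, in isotropic norms): test the class with
`H = ((l-τ)₊)^q`, `Θ = φ³` (`φ` = Lei–Zhang's radial cut-off between `Λ₂ρ` and `(Λ₂+dl/2)ρ`; the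
axis term has a sign and is dropped), `η` a time cut-off (`≡ 1` in (ii));
`…MoserEnergy` gives the slice/dissipation bounds, `…MoserEmbedding` the embedding
`𝒱 ⊂ L^{10/3}`, `…MoserEmbed` the Hölder `(3,2,6)` splitting of the drift term and the absorption,
`…MoserDrift` the drift norm `‖U‖³_{L³(Q)} ≲ ρ²` and the constants.

Theorems only, standard axioms, no `sorry`.

WHAT THIS IS NOT: not a proof of `lemma22_smallSublevel_lowerBound` (M2, seat c) nor of Lemma 2.2;
not a claim about NS regularity or blow-up; not a claim about any author beyond the typed locator.

## References

* A. I. Nazarov, N. N. Uraltseva, St. Petersburg Math. J. 23 (2012) 93–115 = arXiv:1011.1888,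
  §3, Lemma 3.1, (3.2)–(3.6), Remarks 5, 6, 9. [NazarovUraltseva2012]
* Z. Lei, Q. S. Zhang, J. Funct. Anal. 261 (2011) = arXiv:1011.5066, §2 (2.1). [LeiZhang2011]
* G. Seregin, Anal. Math. Phys. 10 (2020), Paper 46 = arXiv:2006.04140, Lemma 2.2. [Seregin2020]
-/

-- the problem directory repeats the summit name (D-0017); core's `dupNamespace` linter fires
set_option linter.dupNamespace false

noncomputable section

open MeasureTheory Set Function Filter Topology Metric
open scoped NNReal ENNReal RealInnerProductSpace

namespace Summit.NavierStokesRegularity.NavierStokesRegularity.Theorems.AxisymmetricKatoGlobal.EulerScaling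

open Literature.Analysis.FluidPDE Literature.Analysis.FluidPDE.LeiZhang2011

/-! ### The registered atom `lemma22_moserStep` -/

/-- Real bookkeeping for the first constant: with `L_φ = C_φ/((dl/2)ρ)` and
`B_η ≤ C_T/(dθ ρ²)` (or `B_η = 0`), `2c₁(36 L_φ² + B_η) ≤ 2c₁(144 C_φ² + C_T) d^{-2} ρ^{-2}` for any
`0 < d ≤ min(dl, dθ)`-type product `d = dl·dθ'` with `dθ' ∈ ]0,1]`, `dθ ≥ d`... stated in the form
used below: `d ≤ dl`, `B_η ≤ C_T/(d²ρ²)`. [cite: NazarovUraltseva2012, proof of Lemma 3.1, (3.4)–(3.6) (the cut-off constants 2^m C₃/((λ-1)R), 4^m C/(θR²))] -/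
theorem moser_constant_one {c₁ Cφ CT dl d ρ Bη : ℝ} (hc₁ : 0 ≤ c₁)
    (hdl : 0 < dl) (hd : 0 < d) (hddl : d ≤ dl) (hρ : 0 < ρ)
    (hBη : Bη ≤ CT / (d ^ 2 * ρ ^ 2)) :
    2 * c₁ * (36 * (Cφ / (dl / 2 * ρ)) ^ 2 + Bη) ≤
      2 * c₁ * (144 * Cφ ^ 2 + CT) * d ^ (-(2 : ℝ)) * ρ ^ (-(2 : ℝ)) := by
  have hd2 : d ^ (-(2 : ℝ)) = 1 / d ^ 2 := by
    rw [Real.rpow_neg hd.le, one_div]; norm_cast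
  have hρ2 : ρ ^ (-(2 : ℝ)) = 1 / ρ ^ 2 := by
    rw [Real.rpow_neg hρ.le, one_div]; norm_cast
  rw [hd2, hρ2]
  have h1 : 36 * (Cφ / (dl / 2 * ρ)) ^ 2 = 144 * Cφ ^ 2 * (1 / (dl ^ 2 * ρ ^ 2)) := by
    field_simp; ring
  have h2 : 1 / (dl ^ 2 * ρ ^ 2) ≤ 1 / (d ^ 2 * ρ ^ 2) := by
    apply one_div_le_one_div_of_le (by positivity)
    have : d ^ 2 ≤ dl ^ 2 := pow_le_pow_left₀ hd.le hddl 2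
    nlinarith [sq_nonneg ρ]
  have h3 : Bη ≤ CT * (1 / (d ^ 2 * ρ ^ 2)) := by rwa [← div_eq_mul_one_div]
  calc 2 * c₁ * (36 * (Cφ / (dl / 2 * ρ)) ^ 2 + Bη)
      = 2 * c₁ * (144 * Cφ ^ 2 * (1 / (dl ^ 2 * ρ ^ 2)) + Bη) := by rw [h1]
    _ ≤ 2 * c₁ * (144 * Cφ ^ 2 * (1 / (d ^ 2 * ρ ^ 2)) + CT * (1 / (d ^ 2 * ρ ^ 2))) := by
        gcongr
    _ = 2 * c₁ * (144 * Cφ ^ 2 + CT) * (1 / d ^ 2) * (1 / ρ ^ 2) := by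
        field_simp

/-- Real bookkeeping for the second constant: with `u⁶ = (8 c_U ρ²)²` and `L_φ = C_φ/((dl/2)ρ)`,
`(2c₁u)⁶ · 729 L_φ⁶ ≤ (64·64·729·64) c₁⁶ c_U² C_φ⁶ d^{-6} ρ^{-2}` for `0 < d ≤ dl`. [cite: NazarovUraltseva2012, proof of Lemma 3.1, (3.6)] -/
theorem moser_constant_two {c₁ cU Cφ dl d ρ : ℝ} (hcU : 0 ≤ cU)
    (hdl : 0 < dl) (hd : 0 < d) (hddl : d ≤ dl) (hρ : 0 < ρ) :
    (2 * c₁ * (8 * (cU * ρ ^ 2)) ^ ((1 : ℝ) / 3)) ^ 6 * (729 * (Cφ / (dl / 2 * ρ)) ^ 6) ≤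
      (64 * 64 * 729 * 64 * c₁ ^ 6 * cU ^ 2 * Cφ ^ 6) * d ^ (-(6 : ℝ)) * ρ ^ (-(2 : ℝ)) := by
  have hu : ((8 * (cU * ρ ^ 2)) ^ ((1 : ℝ) / 3)) ^ 6 = (8 * (cU * ρ ^ 2)) ^ 2 := by
    rw [← Real.rpow_natCast, ← Real.rpow_mul (by positivity)]; norm_num
  have hd6 : d ^ (-(6 : ℝ)) = 1 / d ^ 6 := by
    rw [Real.rpow_neg hd.le, one_div]; norm_cast
  have hρ2 : ρ ^ (-(2 : ℝ)) = 1 / ρ ^ 2 := by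
    rw [Real.rpow_neg hρ.le, one_div]; norm_cast
  rw [mul_pow, mul_pow, hu, hd6, hρ2]
  have hL : (Cφ / (dl / 2 * ρ)) ^ 6 = 64 * Cφ ^ 6 * (1 / (dl ^ 6 * ρ ^ 6)) := by
    field_simp; ring
  rw [hL]
  have hdd : 1 / (dl ^ 6 * ρ ^ 6) ≤ 1 / (d ^ 6 * ρ ^ 6) := by
    apply one_div_le_one_div_of_le (by positivity)
    have : d ^ 6 ≤ dl ^ 6 := pow_le_pow_left₀ hd.le hddl 6
    exact mul_le_mul_of_nonneg_right this (by positivity)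
  calc 2 ^ 6 * c₁ ^ 6 * (8 * (cU * ρ ^ 2)) ^ 2 * (729 * (64 * Cφ ^ 6 * (1 / (dl ^ 6 * ρ ^ 6))))
      ≤ 2 ^ 6 * c₁ ^ 6 * (8 * (cU * ρ ^ 2)) ^ 2 * (729 * (64 * Cφ ^ 6 * (1 / (d ^ 6 * ρ ^ 6)))) := by
        gcongr
    _ = (64 * 64 * 729 * 64 * c₁ ^ 6 * cU ^ 2 * Cφ ^ 6) * (1 / d ^ 6) * (1 / ρ ^ 2) := by
        field_simp; ring

/-- **Nazarov–Uraltseva 2012, Lemma 3.1 — ONE Moser step (3.2)–(3.6) with Remark 6, in Seregin's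
class 𝒱 (Remark 9), registered atom M1 of stmt-NavierStokesRegularity-15453.** See the module
docstring; `C₀ = (K₁+K₂)^{5/3}` with `K₁, K₂` depending on `N`, `Θmax` and three absolute constants
(Sobolev, the radial cut-off, `smoothTransition'`), `A = 10`. [cite: NazarovUraltseva2012, Lemma 3.1, (3.2)–(3.6), Remarks 5, 6, 9; Seregin2020, Lemma 2.2] -/
theorem lemma22_moserStep : ∀ (N : ℝ≥0) (Θmax : ℝ), 0 < Θmax → ∃ C₀ A : ℝ, 0 ≤ C₀ ∧ 0 ≤ A ∧ ∀ (Φ : ℝ → EuclideanSpace ℝ (Fin 3) → ℝ) (U : ℝ → EuclideanSpace ℝ (Fin 3) → EuclideanSpace ℝ (Fin 3)) (S : Set (ℝ × EuclideanSpace ℝ (Fin 3))) (k R : ℝ), (0 < k ∧ 0 < R ∧ Measurable (uncurry Φ) ∧ AEStronglyMeasurable (uncurry U) volume ∧ IsClosed S ∧ (∀ z ∈ S, cylRadius z.2 = 0) ∧ ContinuousOn (uncurry Φ) ({z : ℝ × EuclideanSpace ℝ (Fin 3) | z.1 < 0} \ S) ∧ (∀ t x, 0 ≤ Φ t x) ∧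 (∀ᵐ t : ℝ, t ∈ Ioo (-R ^ 2) 0 → ContDiff ℝ 1 (Φ t)) ∧ (∫⁻ s in Ioo (-R ^ 2) 0, (∫⁻ y in ball (0 : EuclideanSpace ℝ (Fin 3)) (2 * R), ‖U s y‖ₑ ^ (3 : ℕ)) ^ (4 / 3 : ℝ) ≤ (N : ℝ≥0∞) * ENNReal.ofReal R ^ 2) ∧ (∀ (H : ℝ → ℝ), ContDiff ℝ 2 H → (∀ v, deriv H v ≤ 0) → (∀ v, 0 ≤ H v) → (∀ v, 0 ≤ deriv (deriv H) v) → (∀ v, deriv H v ^ 2 ≤ 2 * H v * deriv (deriv H) v) → (∀ v, k ≤ v → H v = 0) → ∀ (Θ : EuclideanSpace ℝ (Fin 3) → ℝ), ContDiff ℝ 1 Θ → HasCompactSupport Θ → tsupport Θ ⊆ ball (0 : EuclideanSpace ℝ (Fin 3)) (2 * R) → ∀ (η : ℝ → ℝ), ContDiff ℝ 1 η → (∀ s, 0 ≤ η s) → ∀ (t₁ t₂ : ℝ), -R ^ 2 < t₁ → t₁ ≤ t₂ → t₂ < 0 → ENNReal.ofReal (η t₂ * ∫ x, H (Φ t₂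 x) * Θ x ^ 2) + ∫⁻ z in Icc t₁ t₂ ×ˢ (univ : Set (EuclideanSpace ℝ (Fin 3))), ENNReal.ofReal (1 / 2 * η z.1 * (deriv (deriv H) (Φ z.1 z.2) * ‖gradient (Φ z.1) z.2‖ ^ 2 * Θ z.2 ^ 2)) ≤ ENNReal.ofReal (η t₁ * (∫ x, H (Φ t₁ x) * Θ x ^ 2) + (4 * ∫ z in Icc t₁ t₂ ×ˢ (univ : Set (EuclideanSpace ℝ (Fin 3))), η z.1 * (H (Φ z.1 z.2) * ‖gradient Θ z.2‖ ^ 2)) + (∫ z in Icc t₁ t₂ ×ˢ (univ : Set (EuclideanSpace ℝ (Fin 3))), η z.1 * (H (Φ z.1 z.2) * inner ℝ (U z.1 z.2) (gradient (fun y => Θ y ^ 2) z.2))) + (∫ z in Icc t₁ t₂ ×ˢ (univ : Set (EuclideanSpace ℝ (Fin 3))), η z.1 * (2 / cylRadius z.2 * (H (Φ z.1 z.2) * fderiv ℝ (fun y => Θ y ^ 2) z.2 (eR z.2)))) + (∫ z in Icc t₁ t₂ ×ˢ (univ : Set (EuclideanSpace ℝ (Fin 3))), |deriv η z.1| * (H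 (Φ z.1 z.2) * Θ z.2 ^ 2))))) → ∀ (ρ Λ₁ Λ₂ Θ₁ Θ₂ dl dθ t₀ l q : ℝ), R / 4 ≤ ρ → 1 ≤ Λ₂ → Λ₂ + dl ≤ Λ₁ → Λ₁ * ρ ≤ 2 * R → 0 < dl → dl ≤ 1 → 0 < Θ₂ → Θ₂ + dθ ≤ Θ₁ → Θ₁ ≤ Θmax → 0 < dθ → dθ ≤ 1 → t₀ ≤ 0 → -R ^ 2 < t₀ - Θ₁ * ρ ^ 2 → 0 < l → l ≤ k → 2 < q → (∫⁻ z in Ioo (t₀ - Θ₂ * ρ ^ 2) t₀ ×ˢ ball (0 : EuclideanSpace ℝ (Fin 3)) (Λ₂ * ρ), ENNReal.ofReal (max (l - Φ z.1 z.2) 0 ^ (5 / 3 * q)) ≤ ENNReal.ofReal (C₀ * (dl * dθ) ^ (-A) * ρ ^ (-(10 / 3 : ℝ))) * (∫⁻ z in Ioo (t₀ - Θ₁ * ρ ^ 2) t₀ ×ˢ ball (0 : EuclideanSpace ℝ (Fin 3)) (Λ₁ * ρ), ENNReal.ofReal (max (l - Φ z.1 z.2) 0 ^ q)) ^ (5 /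 3 : ℝ)) ∧ ((∀ᵐ x ∂(volume.restrict (ball (0 : EuclideanSpace ℝ (Fin 3)) (Λ₁ * ρ))), l ≤ Φ (t₀ - Θ₁ * ρ ^ 2) x) → ∫⁻ z in Ioo (t₀ - Θ₁ * ρ ^ 2) t₀ ×ˢ ball (0 : EuclideanSpace ℝ (Fin 3)) (Λ₂ * ρ), ENNReal.ofReal (max (l - Φ z.1 z.2) 0 ^ (5 / 3 * q)) ≤ ENNReal.ofReal (C₀ * dl ^ (-A) * ρ ^ (-(10 / 3 : ℝ))) * (∫⁻ z in Ioo (t₀ - Θ₁ * ρ ^ 2) t₀ ×ˢ ball (0 : EuclideanSpace ℝ (Fin 3)) (Λ₁ * ρ), ENNReal.ofReal (max (l - Φ z.1 z.2) 0 ^ q)) ^ (5 / 3 : ℝ)) := by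
  intro N Θmax hΘmax
  ----------------------------------------------------------------
  -- the constants
  ----------------------------------------------------------------
  obtain ⟨Cφ, hCφ0, hCφ⟩ := exists_norm_fderiv_radialCutoff_le
  obtain ⟨CT, hCT0, hCT⟩ := LeiZhang2011.exists_abs_deriv_smoothTransition_le
  set cS : ℝ := ((SNormLESNormFDerivOfEqConst ℝ (volume : Measure (EuclideanSpace ℝ (Fin 3))) 2
    : ℝ≥0) : ℝ) with hcS
  have hcS0 : 0 ≤ cS := NNReal.coe_nonneg _
  set c₁ : ℝ := (3 * cS ^ 2) ^ ((3 : ℝ) / 5) with hc₁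
  have hc₁0 : 0 ≤ c₁ := Real.rpow_nonneg (by positivity) _
  set cU : ℝ := Θmax ^ ((1 : ℝ) / 4) * (16 * N) ^ ((3 : ℝ) / 4) with hcU
  have hcU0 : 0 ≤ cU := mul_nonneg (Real.rpow_nonneg hΘmax.le _) (Real.rpow_nonneg (by positivity) _)
  set K₁ : ℝ := 2 * c₁ * (144 * Cφ ^ 2 + CT) with hK₁
  set K₂ : ℝ := 64 * 64 * 729 * 64 * c₁ ^ 6 * cU ^ 2 * Cφ ^ 6 with hK₂
  have hK₁0 : 0 ≤ K₁ := by positivity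
  have hK₂0 : 0 ≤ K₂ := by positivity
  refine ⟨(K₁ + K₂) ^ ((5 : ℝ) / 3), 10, Real.rpow_nonneg (by positivity) _, by norm_num, ?_⟩
  intro Φ U S k R hstand ρ Λ₁ Λ₂ Θ₁ Θ₂ dl dθ t₀ l q hρR hΛ₂ hΛ hΛ₁R hdl0 hdl1 hΘ₂ hΘ hΘ₁max hdθ0
    hdθ1 ht₀ ht₁R hl hlk hq
  obtain ⟨hk, hR, hΦm, hU, -, -, -, hΦ0, hC1, hdrift, hEC⟩ := hstand
  ----------------------------------------------------------------
  -- the geometry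
  ----------------------------------------------------------------
  have hρ : 0 < ρ := lt_of_lt_of_le (by positivity) hρR
  have hρ2 : 0 < ρ ^ 2 := by positivity
  have hΛ₂pos : 0 < Λ₂ := lt_of_lt_of_le one_pos hΛ₂
  set ρ₂ : ℝ := Λ₂ * ρ with hρ₂def
  set ρ₁ : ℝ := (Λ₂ + dl / 2) * ρ with hρ₁def
  have hρ₂pos : 0 < ρ₂ := mul_pos hΛ₂pos hρ
  have hρ₂₁ : ρ₂ < ρ₁ := mul_lt_mul_of_pos_right (by linarith only [hdl0]) hρ
  have hρ₁Λ₁ : ρ₁ < Λ₁ * ρ := mul_lt_mul_of_pos_right (by linarith only [hΛ, hdl0]) hρ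
  have hρ₁R : ρ₁ < 2 * R := lt_of_lt_of_le hρ₁Λ₁ hΛ₁R
  have hgap : ρ₁ - ρ₂ = dl / 2 * ρ := by rw [hρ₁def, hρ₂def]; ring
  set φ : EuclideanSpace ℝ (Fin 3) → ℝ := radialCutoff ρ₂ ρ₁ with hφdef
  set Lφ : ℝ := Cφ / (dl / 2 * ρ) with hLφdef
  have hLφ : ∀ x, ‖fderiv ℝ φ x‖ ≤ Lφ := fun x => by
    rw [hLφdef, ← hgap]; exact hCφ ρ₂ ρ₁ hρ₂pos.le hρ₂₁ x
  set t₁ : ℝ := t₀ - Θ₁ * ρ ^ 2 with ht₁def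
  set s₁ : ℝ := t₀ - Θ₂ * ρ ^ 2 with hs₁def
  have hΘ₁ : Θ₂ < Θ₁ := by linarith only [hΘ, hdθ0]
  have ht₁s₁ : t₁ < s₁ := by
    have h := mul_lt_mul_of_pos_right hΘ₁ hρ2
    show t₀ - Θ₁ * ρ ^ 2 < t₀ - Θ₂ * ρ ^ 2
    linarith only [h]
  have hs₁t₀ : s₁ < t₀ := by
    have h := mul_pos hΘ₂ hρ2
    show t₀ - Θ₂ * ρ ^ 2 < t₀
    linarith only [h]
  have ht₁t₀ : t₁ < t₀ := ht₁s₁.trans hs₁t₀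
  have hst : s₁ - t₁ = (Θ₁ - Θ₂) * ρ ^ 2 := by rw [ht₁def, hs₁def]; ring
  have hst_ge : dθ * ρ ^ 2 ≤ s₁ - t₁ := by
    rw [hst]; exact mul_le_mul_of_nonneg_right (by linarith only [hΘ]) hρ2.le
  have hlen : t₀ - t₁ ≤ Θmax * ρ ^ 2 := by
    have h := mul_le_mul_of_nonneg_right hΘ₁max hρ2.le
    show t₀ - (t₀ - Θ₁ * ρ ^ 2) ≤ Θmax * ρ ^ 2
    linarith only [h]
  -- the reference integrals
  set V : ℝ × EuclideanSpace ℝ (Fin 3) → ℝ := fun z => max (l - Φ z.1 z.2) 0 with hV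
  have hV0 : ∀ z, 0 ≤ V z := fun z => le_max_right _ _
  set I : ℝ≥0∞ := ∫⁻ z in Ioo t₁ t₀ ×ˢ ball (0 : EuclideanSpace ℝ (Fin 3)) (Λ₁ * ρ),
    ENNReal.ofReal (V z ^ q) with hI
  set I₁ : ℝ≥0∞ := ∫⁻ z in Ioo t₁ t₀ ×ˢ closedBall (0 : EuclideanSpace ℝ (Fin 3)) ρ₁,
    ENNReal.ofReal (V z ^ q) with hI₁
  have hI₁I : I₁ ≤ I := lintegral_mono_set (prod_mono le_rfl (closedBall_subset_ball hρ₁Λ₁))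
  set U₃ : ℝ≥0∞ := ∫⁻ z in Ioo t₁ t₀ ×ˢ closedBall (0 : EuclideanSpace ℝ (Fin 3)) ρ₁,
    ‖U z.1 z.2‖ₑ ^ (3 : ℕ) with hU₃
  have hU₃ : U₃ ≤ ENNReal.ofReal (cU * ρ ^ 2) := by
    have h := lintegral_drift_cube_le hU hdrift hR hρR ht₁R.le ht₀ hΘmax.le hlen
      (B := closedBall (0 : EuclideanSpace ℝ (Fin 3)) ρ₁) (closedBall_subset_ball hρ₁R)
    rw [hcU, mul_assoc]
    simpa only [mul_assoc] using h
  -- `C₁ = ofReal c₁`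
  set CS : ℝ≥0∞ := (SNormLESNormFDerivOfEqConst ℝ (volume : Measure (EuclideanSpace ℝ (Fin 3))) 2
    : ℝ≥0∞) with hCS
  have hC₁ : (3 * CS ^ 2) ^ ((3 : ℝ) / 5) = ENNReal.ofReal c₁ := by
    rw [hc₁, ← ENNReal.ofReal_rpow_of_nonneg (by positivity) (by norm_num),
      ENNReal.ofReal_mul (by norm_num : (0 : ℝ) ≤ 3), ENNReal.ofReal_ofNat, ENNReal.ofReal_pow hcS0,
      hcS, ENNReal.ofReal_coe_nnreal]
  ----------------------------------------------------------------
  -- the common final estimate, for a time weight `η` with `|η'| ≤ Bη ≤ CT/(dθ ρ²)` and a gap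
  -- parameter `d` (`d = dl·dθ` in (i), `d = dl` in (ii))
  ----------------------------------------------------------------
  have hfinal : ∀ (η : ℝ → ℝ) (Bη d : ℝ), ContDiff ℝ 1 η → (∀ s, 0 ≤ η s ∧ η s ≤ 1) → 0 ≤ Bη →
      (∀ s, |deriv η s| ≤ Bη) → Bη ≤ CT / (d ^ 2 * ρ ^ 2) →
      η t₁ * (∫ x, max (l - Φ t₁ x) 0 ^ q * (φ x ^ 3) ^ 2) = 0 →
      0 < d → d ≤ dl → d ≤ 1 →
      ∫⁻ z in Ioo t₁ t₀ ×ˢ (univ : Set (EuclideanSpace ℝ (Fin 3))),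
          ENNReal.ofReal ((η z.1 ^ ((1 : ℝ) / 2) * max (l - Φ z.1 z.2) 0 ^ (q / 2) * φ z.2 ^ 3) ^
            ((10 : ℝ) / 3)) ≤
        ENNReal.ofReal ((K₁ + K₂) ^ ((5 : ℝ) / 3) * d ^ (-(10 : ℝ)) * ρ ^ (-(10 / 3 : ℝ))) *
          I ^ ((5 : ℝ) / 3) := by
    intro η Bη d hη hη01 hBη0 hBη hBηle hinit hd hddl hd1
    have hcore := moser_reverse_holder_core Φ U k R hΦm hΦ0 hC1 hU hEC hρ₂pos hρ₂₁ hρ₁R ht₁R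
      ht₁t₀ ht₀ hl hlk hq hφdef hLφ hη hη01 hBη0 hBη hinit
    refine hcore.trans ?_
    rw [hC₁]
    -- the two pieces
    set G : ℝ≥0∞ := (ENNReal.ofReal (729 * Lφ ^ 6) * I₁) ^ ((1 : ℝ) / 6) with hG
    have hA : 2 * ENNReal.ofReal c₁ * (ENNReal.ofReal (36 * Lφ ^ 2 + Bη) * I₁) ≤
        ENNReal.ofReal (K₁ * d ^ (-(2 : ℝ)) * ρ ^ (-(2 : ℝ))) * I := by
      have hreal := moser_constant_one (Cφ := Cφ) hc₁0 hdl0 hd hddl hρ hBηle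
      calc 2 * ENNReal.ofReal c₁ * (ENNReal.ofReal (36 * Lφ ^ 2 + Bη) * I₁)
          = ENNReal.ofReal (2 * c₁ * (36 * (Cφ / (dl / 2 * ρ)) ^ 2 + Bη)) * I₁ := by
            rw [← ENNReal.ofReal_ofNat 2, ← ENNReal.ofReal_mul (by norm_num), ← mul_assoc,
              ← ENNReal.ofReal_mul (by positivity), hLφdef]
        _ ≤ ENNReal.ofReal (K₁ * d ^ (-(2 : ℝ)) * ρ ^ (-(2 : ℝ))) * I := by
            gcongr
    have hB : (2 * ENNReal.ofReal c₁ * ((8 * U₃) ^ ((1 : ℝ) / 3) * G)) ^ (6 : ℕ) ≤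
        ENNReal.ofReal (K₂ * d ^ (-(6 : ℝ)) * ρ ^ (-(2 : ℝ))) * I := by
      have hreal := moser_constant_two (c₁ := c₁) (Cφ := Cφ) hcU0 hdl0 hd hddl hρ
      -- bound `(8 U₃)^{1/3}` and `G` by real quantities
      have h8U : (8 * U₃) ^ ((1 : ℝ) / 3) ≤ ENNReal.ofReal ((8 * (cU * ρ ^ 2)) ^ ((1 : ℝ) / 3)) := by
        rw [← ENNReal.ofReal_rpow_of_nonneg (by positivity) (by norm_num)]
        refine ENNReal.rpow_le_rpow ?_ (by norm_num)
        rw [ENNReal.ofReal_mul (by norm_num), ENNReal.ofReal_ofNat]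
        gcongr
      have hG6 : G ^ (6 : ℕ) ≤ ENNReal.ofReal (729 * Lφ ^ 6) * I := by
        rw [hG, ← ENNReal.rpow_natCast, ← ENNReal.rpow_mul]
        norm_num
        gcongr
      calc (2 * ENNReal.ofReal c₁ * ((8 * U₃) ^ ((1 : ℝ) / 3) * G)) ^ (6 : ℕ)
          = (2 * ENNReal.ofReal c₁ * (8 * U₃) ^ ((1 : ℝ) / 3)) ^ (6 : ℕ) * G ^ (6 : ℕ) := by
            rw [← mul_pow]; ring
        _ ≤ (2 * ENNReal.ofReal c₁ * ENNReal.ofReal ((8 * (cU * ρ ^ 2)) ^ ((1 : ℝ) / 3))) ^ (6 : ℕ) *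
              (ENNReal.ofReal (729 * Lφ ^ 6) * I) := by gcongr
        _ = ENNReal.ofReal ((2 * c₁ * (8 * (cU * ρ ^ 2)) ^ ((1 : ℝ) / 3)) ^ 6 *
              (729 * (Cφ / (dl / 2 * ρ)) ^ 6)) * I := by
            rw [← ENNReal.ofReal_ofNat 2, ← ENNReal.ofReal_mul (by norm_num),
              ← ENNReal.ofReal_mul (by positivity), ← ENNReal.ofReal_pow (by positivity),
              ← mul_assoc, ← ENNReal.ofReal_mul (by positivity), hLφdef]
        _ ≤ ENNReal.ofReal (K₂ * d ^ (-(6 : ℝ)) * ρ ^ (-(2 : ℝ))) * I := by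
            gcongr
    calc (2 * ENNReal.ofReal c₁ * (ENNReal.ofReal (36 * Lφ ^ 2 + Bη) * I₁) +
          (2 * ENNReal.ofReal c₁ * ((8 * U₃) ^ ((1 : ℝ) / 3) * G)) ^ (6 : ℕ)) ^ ((5 : ℝ) / 3)
        ≤ (ENNReal.ofReal (K₁ * d ^ (-(2 : ℝ)) * ρ ^ (-(2 : ℝ))) * I +
            ENNReal.ofReal (K₂ * d ^ (-(6 : ℝ)) * ρ ^ (-(2 : ℝ))) * I) ^ ((5 : ℝ) / 3) :=
          ENNReal.rpow_le_rpow (add_le_add hA hB) (by norm_num)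
      _ ≤ _ := rpow_five_thirds_final_bound hK₁0 hK₂0 hd hd1 hρ I
  ----------------------------------------------------------------
  -- the lower bound: on `]s, t₀[ × B(Λ₂ρ)` with `η = 1` there, `w^{10/3} = (l-Φ)₊^{(5/3)q}`
  ----------------------------------------------------------------
  have hlower : ∀ (η : ℝ → ℝ) (s : ℝ), t₁ ≤ s → (∀ t, s ≤ t → η t = 1) → (∀ t, 0 ≤ η t) →
      ∫⁻ z in Ioo s t₀ ×ˢ ball (0 : EuclideanSpace ℝ (Fin 3)) (Λ₂ * ρ),
          ENNReal.ofReal (max (l - Φ z.1 z.2) 0 ^ (5 / 3 * q)) ≤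
        ∫⁻ z in Ioo t₁ t₀ ×ˢ (univ : Set (EuclideanSpace ℝ (Fin 3))),
          ENNReal.ofReal ((η z.1 ^ ((1 : ℝ) / 2) * max (l - Φ z.1 z.2) 0 ^ (q / 2) * φ z.2 ^ 3) ^
            ((10 : ℝ) / 3)) := by
    intro η s hs hη1 hη0
    have hsub : Ioo s t₀ ×ˢ ball (0 : EuclideanSpace ℝ (Fin 3)) (Λ₂ * ρ) ⊆
        Ioo t₁ t₀ ×ˢ (univ : Set (EuclideanSpace ℝ (Fin 3))) :=
      prod_mono (Ioo_subset_Ioo_left hs) (subset_univ _)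
    have heq : ∀ z ∈ Ioo s t₀ ×ˢ ball (0 : EuclideanSpace ℝ (Fin 3)) (Λ₂ * ρ),
        ENNReal.ofReal (max (l - Φ z.1 z.2) 0 ^ (5 / 3 * q)) =
          ENNReal.ofReal ((η z.1 ^ ((1 : ℝ) / 2) * max (l - Φ z.1 z.2) 0 ^ (q / 2) * φ z.2 ^ 3) ^
            ((10 : ℝ) / 3)) := by
      intro z hz
      have h1 : η z.1 = 1 := hη1 z.1 hz.1.1.le
      have h2 : φ z.2 = 1 := by
        rw [hφdef]
        exact radialCutoff_eq_one hρ₂pos.le hρ₂₁ (by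
          rw [hρ₂def]; exact (mem_ball_zero_iff.1 hz.2).le)
      rw [h1, h2, Real.one_rpow, one_mul, one_pow, mul_one, ← Real.rpow_mul (hV0 z)]
      congr 2; ring
    calc ∫⁻ z in Ioo s t₀ ×ˢ ball (0 : EuclideanSpace ℝ (Fin 3)) (Λ₂ * ρ),
          ENNReal.ofReal (max (l - Φ z.1 z.2) 0 ^ (5 / 3 * q))
        = ∫⁻ z in Ioo s t₀ ×ˢ ball (0 : EuclideanSpace ℝ (Fin 3)) (Λ₂ * ρ),
            ENNReal.ofReal ((η z.1 ^ ((1 : ℝ) / 2) * max (l - Φ z.1 z.2) 0 ^ (q / 2) * φ z.2 ^ 3) ^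
              ((10 : ℝ) / 3)) :=
          setLIntegral_congr_fun (measurableSet_Ioo.prod measurableSet_ball) heq
      _ ≤ _ := lintegral_mono_set hsub
  ----------------------------------------------------------------
  -- (i) and (ii)
  ----------------------------------------------------------------
  have hdd : 0 < dl * dθ := mul_pos hdl0 hdθ0
  have hdd1 : dl * dθ ≤ 1 := mul_le_one₀ hdl1 hdθ0.le hdθ1
  have hdddl : dl * dθ ≤ dl := mul_le_of_le_one_right hdl0.le hdθ1
  have hdddθ : (dl * dθ) ^ 2 * ρ ^ 2 ≤ dθ * ρ ^ 2 := by
    refine mul_le_mul_of_nonneg_right ?_ hρ2.le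
    calc (dl * dθ) ^ 2 = (dl ^ 2 * dθ) * dθ := by ring
      _ ≤ 1 * dθ := mul_le_mul_of_nonneg_right
          (mul_le_one₀ (pow_le_one₀ hdl0.le hdl1) hdθ0.le hdθ1) hdθ0.le
      _ = dθ := one_mul _
  have hq0 : q ≠ 0 := (lt_trans two_pos hq).ne'
  refine ⟨?_, fun hinit0 => ?_⟩
  · -- (i): the time cut-off between `t₁` and `s₁`
    set η : ℝ → ℝ := fun s => Real.smoothTransition ((s - t₁) / (s₁ - t₁)) with hηdef
    obtain ⟨hηC1, hηt₁, hη1, hη01, hηd⟩ := moserTime_props ht₁s₁ hCT hηdef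
    have hBηle : CT / (s₁ - t₁) ≤ CT / ((dl * dθ) ^ 2 * ρ ^ 2) :=
      div_le_div_of_nonneg_left hCT0 (by positivity) (hdddθ.trans hst_ge)
    have hinit : η t₁ * (∫ x, max (l - Φ t₁ x) 0 ^ q * (φ x ^ 3) ^ 2) = 0 := by
      rw [hηt₁, zero_mul]
    have h := hfinal η (CT / (s₁ - t₁)) (dl * dθ) hηC1 hη01 (by positivity) hηd hBηle hinit hdd
      hdddl hdd1
    exact (hlower η s₁ ht₁s₁.le hη1 fun t => (hη01 t).1).trans h
  · -- (ii): `η ≡ 1` on the full window, the initial slice vanishes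
    set η : ℝ → ℝ := fun _ => 1 with hηdef
    have hηC1 : ContDiff ℝ 1 η := contDiff_const
    have hη01 : ∀ s, 0 ≤ η s ∧ η s ≤ 1 := fun s => ⟨zero_le_one, le_rfl⟩
    have hηd : ∀ s, |deriv η s| ≤ 0 := fun s => by
      rw [hηdef, deriv_const]; simp
    have hinit : η t₁ * (∫ x, max (l - Φ t₁ x) 0 ^ q * (φ x ^ 3) ^ 2) = 0 := by
      have hae : (fun x => max (l - Φ t₁ x) 0 ^ q * (φ x ^ 3) ^ 2) =ᵐ[volume] fun _ => 0 := by
        have hball : ∀ᵐ x ∂(volume : Measure (EuclideanSpace ℝ (Fin 3))),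
            x ∈ ball (0 : EuclideanSpace ℝ (Fin 3)) (Λ₁ * ρ) → l ≤ Φ t₁ x :=
          (ae_restrict_iff' measurableSet_ball).1 hinit0
        filter_upwards [hball] with x hx
        by_cases hxB : x ∈ ball (0 : EuclideanSpace ℝ (Fin 3)) (Λ₁ * ρ)
        · have hle : l - Φ t₁ x ≤ 0 := sub_nonpos.2 (hx hxB)
          rw [max_eq_right hle, Real.zero_rpow hq0]; simp
        · have hxK : φ x = 0 := by
            rw [hφdef]
            refine radialCutoff_eq_zero hρ₂pos.le hρ₂₁ ?_
            have : Λ₁ * ρ ≤ ‖x‖ := by simpa [mem_ball_zero_iff] using hxB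
            exact hρ₁Λ₁.le.trans this
          rw [hxK]; simp
      rw [integral_congr_ae hae, integral_zero, mul_zero]
    have hB0 : (0 : ℝ) ≤ CT / (dl ^ 2 * ρ ^ 2) := by positivity
    have h := hfinal η 0 dl hηC1 hη01 le_rfl hηd hB0 hinit hdl0 le_rfl hdl1
    have hlow := hlower η t₁ le_rfl (fun t _ => rfl) fun t => zero_le_one
    exact hlow.trans h

end Summit.NavierStokesRegularity.NavierStokesRegularity.Theorems.AxisymmetricKatoGlobal.EulerScaling

end
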